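import Literature.MathematicalPhysics.QuantumFieldTheory.Balaban1983to89.B13Bound226Witness
import Literature.MathematicalPhysics.QuantumFieldTheory.Balaban1983to89.B13Bound226CentredUnscaled

/-!
# `Balaban1983to89.B13Bound226WitnessCentred` — T. Bałaban, *Renormalization group approach to lattice gauge field theories.
II. Cluster expansions*, Commun. Math. Phys. **116** (1988) 1–22 [Balaban1988RG2Cluster], pp. 15–17, with [Balaban1987RG1]
(2.9)–(2.13) pp. 266–268: **THE A2 ∕ A6 JOINT WITNESS FOR THE CENTRED LOCAL-GROWTH MEMBER ENGINE** — the full binder list of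
`B13Bound226CentredUnscaled.h226_torus_windowDilated_centred_of_localGrowth_perBond_member` (the consumer-facing centred
(2.26) along the window-dilated family of the unscaled-field law, from LOCAL growth letters with the PER-BOND rate; the engine
node N22's J7b ∕ J10b key on) is met at the one-bond model of `B13Bound226Witness` with its local-growth last line
(cubic Wilson part `κ₃A₀³` = its own third-order part, affine older part `1 + κ₁A₀` with linear part `κ₁A₀`), for EVERY
torus, site torus, block, term label, large-field radius, coupling `s > 0` and constants record of the chain — certified by the
kernel by APPLYING the engine with every binder discharged

statement-level skeleton of published theorems with citation tags; proofs where landed; nothing here is a claim about the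
Yang–Mills mass gap

CITATION HEADER.  As in `B13Bound226Witness` and `B13Bound226CentredUnscaled` ([II] (2.20) p.16, (2.22) p.16, (2.24)–(2.26)
p.17, (1.39) p.10, (1.42) p.11; [I] (2.9)–(2.13) pp.266–268).  NOT PRINTED: the model data (WITNESS DATA for typed hypothesis
lists, not Bałaban's objects).

WHY THIS FILE (cell `pub-ymgap`, D-0062 Track A, node N10 = [B13], seat `pub-ymgap-dag-n10-c` g10, module 53; companion of module
52 `B13Bound226Witness`).  The director's STANDING A6 RULE (№189 (3)) and the N22 finding №193 concern the knits ONE storey above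
the four window-dilated engines of this lane; module 52 witnessed three of them (41 §4 members, 43B §2 box tail, 43B §4 ∕ 47 §5
large field, 47 §2 local-growth members); this file witnesses the fourth — the CENTRED engine with its parity binders
(`χ`, `χᶜ` EVEN), the third-order ∕ linear parts `𝒲₃`, `D𝒪` with their homogeneities, the seven local letters (L0)–(L6), the
Y-localised cubic letter and per-bond multiplicity, the box-SUPPORT law, the rate condition `2δ + 8ρm₃ ≤ a_c` and the explicit
weighted-constants letter `hwc` — jointly with the kernels ∕ regions ∕ numerics block of module 52.

THE MODEL (additions to `B13Bound226Witness` §1–§4, §8).  `𝒲 = 𝒲₃ := Wc κ₃` (cubic, so `𝒲 − 𝒲₃ = 0`: `c₄ = 0`; homogeneous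
of degree 3: `Wc_smul`; (L1)∕(L3) `c₃ = c₃′ = κ₃`: `Wc_cubic`), `𝒪 := Oa κ₁`, `D𝒪 := DOa κ₁ = κ₁A₀` (linear: `DOa_smul`; (L5)
`c₂ = 0`, (L6) `c₁′ = κ₁`: `Oa_taylor`), `c₀ = 1`, `c₁ = κ₁` (module 52's `Oa_letters`); `κ₃ := kap3∕8` (so `8ρ·κ₃S ≤ 1∕64`),
`κ₁ := kap1`, `δ := 1∕64`, `a_c := 1∕16` (= module 52's `a′`, so the numerics block is module 52's verbatim), `w_c :=` the
left side of `hwc` itself (`x ≤ e^x`; `wcModel_nonneg`); parity of the model's `χ_{Y₀}`, `χᶜ_P` (functions of `⟨B,B⟩`: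
`chi_even`).

WHAT IS HERE.  §1 `DOa` (def) + `Wc_smul`, `DOa_smul`, `Wc_cubic`, `Oa_taylor`, `measurable_DOa`, `chi_even`,
`rate_centred_model`, `wcModel` (def: the weighted-constants expression) + `wcModel_nonneg`, `wcModel_le_exp`;
§2 ★★ `centred_localGrowth_model` (46 §5 APPLIED at the model, every binder discharged: for every `b` of the non-empty ball,
`‖(2.14)_b(member) − (2.14)_b(centre)‖ ≤ s²·weight·e^{a₅|Z|}`).
HONEST SCOPE.  As module 52: a CONSISTENCY certificate (σ-constant kernels; one bond; no `C₀`-variables); nothing of Bałaban's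
asserted; count-neutral; N10 ∕ N22 NOT discharged; nothing continuum ∕ OS ∕ mass-gap ∕ Clay.  No `sorry`; two transparent model
`def`s; no structure, no instance, no new named fact (D-0026).
-/

noncomputable section

namespace Literature.MathematicalPhysics.QuantumFieldTheory.Balaban1983to89.B13Bound226WitnessCentred

open Matrix MeasureTheory Finset Complex Metric Set
open scoped Real
open B13Term214 (core214 F214 term214)
open B13Bound226CentredUnscaled (h226_torus_windowDilated_centred_of_localGrowth_perBond_member)
open B13Bound226Witness
open TreeLengthTorus (TPt TDom tsys)
open TreeLengthTorusTransfer (tclosure)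
open B13Lemma3TorusData (TBond)
open B13Lemma3TorusTerms (weight Z0)
open B13Bound143 (invTau)
open B5TorusCover (UT)
open B9Thm37GlueTorus (tdist1)

/-! ## §1. The centred model's extra letters: third-order ∕ linear parts, homogeneity, Taylor letters, parity, rate, `w_c` -/

section Letters

/-- MODEL (witness data). The linear part of the model's older part: `D𝒪(Y,A) := κ₁·A₀` (the differential of `1 + κ₁A₀` at
`0`). [cite: Balaban1988RG2Cluster, (1.39) p.10] -/
def DOa {D : Type*} (κ₁ : ℝ) (_Y : D) (A : Fin 1 → ℝ) : ℂ := ((κ₁ * A 0 : ℝ) : ℂ)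

/-- The cubic Wilson part is homogeneous of degree three: `𝒲(Y, rA) = r³𝒲(Y,A)`.
[cite: Balaban1987RG1, (2.8)-(2.10) pp.266-267] -/
theorem Wc_smul {D : Type*} (κ₃ : ℝ) (Y : D) (r : ℝ) (A : Fin 1 → ℝ) : Wc κ₃ Y (r • A) = (r : ℂ) ^ 3 * Wc κ₃ Y A := by
  unfold Wc; rw [Pi.smul_apply, smul_eq_mul]; push_cast; ring

/-- The linear part is homogeneous of degree one: `D𝒪(Y, rA) = r·D𝒪(Y,A)`. [cite: Balaban1988RG2Cluster, (1.39) p.10] -/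
theorem DOa_smul {D : Type*} (κ₁ : ℝ) (Y : D) (r : ℝ) (A : Fin 1 → ℝ) : DOa κ₁ Y (r • A) = (r : ℂ) * DOa κ₁ Y A := by
  unfold DOa; rw [Pi.smul_apply, smul_eq_mul]; push_cast; ring

/-- `D𝒪` is measurable. [cite: Balaban1988RG2Cluster, (1.34) p.9] -/
theorem measurable_DOa {D : Type*} (κ₁ : ℝ) (Y : D) : Measurable (DOa κ₁ Y) := by
  have h : Measurable fun A : Fin 1 → ℝ => A 0 := measurable_pi_apply 0
  unfold DOa
  exact Complex.measurable_ofReal.comp (h.const_mul κ₁)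

/-- On one bond the coordinate is dominated by the sup norm: `|A₀| ≤ ‖A‖`. [folklore] -/
private theorem abs_apply_le_norm (A : Fin 1 → ℝ) : |A 0| ≤ ‖A‖ := by
  have h := norm_le_pi_norm A 0
  rwa [Real.norm_eq_abs] at h

/-- **(L1) ∕ (L2) ∕ (L3) FOR THE MODEL's WILSON PART** (`𝒲 = 𝒲₃` cubic): `|𝒲(Y,A)| ≤ κ₃‖A‖³` on the whole field space
(`κ₃ ≥ 0`), and `|𝒲 − 𝒲₃| = 0 ≤ 0·‖A‖⁴`. [cite: Balaban1988RG2Cluster, (1.42) p.11; Balaban1987RG1, (2.8)-(2.10) pp.266-267] -/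
theorem Wc_cubic {D : Type*} {κ₃ : ℝ} (hκ : 0 ≤ κ₃) (Y : D) (A : Fin 1 → ℝ) :
    ‖Wc κ₃ Y A‖ ≤ κ₃ * ‖A‖ ^ 3 ∧ ‖Wc κ₃ Y A - Wc κ₃ Y A‖ ≤ 0 * ‖A‖ ^ 4 := by
  refine ⟨?_, by rw [sub_self, norm_zero, zero_mul]⟩
  unfold Wc
  rw [Complex.norm_real, Real.norm_eq_abs, abs_mul, abs_of_nonneg hκ, abs_pow]
  exact mul_le_mul_of_nonneg_left (pow_le_pow_left₀ (abs_nonneg _) (abs_apply_le_norm A) 3) hκ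

/-- **(L5) ∕ (L6) FOR THE MODEL's OLDER PART**: the affine `𝒪` has Taylor remainder `𝒪(A) − 𝒪(0) − D𝒪(A) = 0 ≤ 0·‖A‖²` and
linear part `|D𝒪(A)| = κ₁|A₀| ≤ κ₁‖A‖` (`κ₁ ≥ 0`). [cite: Balaban1988RG2Cluster, (1.39) p.10] -/
theorem Oa_taylor {D : Type*} {κ₁ : ℝ} (hκ : 0 ≤ κ₁) (Y : D) (A : Fin 1 → ℝ) :
    ‖Oa κ₁ Y A - Oa κ₁ Y 0 - DOa κ₁ Y A‖ ≤ 0 * ‖A‖ ^ 2 ∧ ‖DOa κ₁ Y A‖ ≤ κ₁ * ‖A‖ := by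
  have h : Oa κ₁ Y A - Oa κ₁ Y 0 - DOa κ₁ Y A = 0 := by unfold Oa DOa; push_cast; simp
  refine ⟨by rw [h, norm_zero, zero_mul], ?_⟩
  unfold DOa
  rw [Complex.norm_real, Real.norm_eq_abs, abs_mul, abs_of_nonneg hκ]
  exact mul_le_mul_of_nonneg_left (abs_apply_le_norm A) hκ

/-- **PARITY OF THE MODEL's CHARACTERISTIC FUNCTIONS**: both are functions of `⟨B,B⟩`, hence EVEN.
[cite: Balaban1987RG1, (2.10)-(2.12) pp.267-268] -/
theorem chi_even {Λ : Type} [Fintype Λ] (s s' : ℝ) (B : Λ → ℝ) :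
    chiS s (-B) = chiS s B ∧ chiL s' (-B) = chiL s' B := by
  have h : (-B) ⬝ᵥ (-B) = B ⬝ᵥ B := by rw [neg_dotProduct, dotProduct_neg, neg_neg]
  unfold chiS chiL; rw [h]; exact ⟨rfl, rfl⟩

variable {d L N' : ℕ} [NeZero L] [NeZero N'] {M : ℕ}

/-- **THE RATE CONDITION OF THE CENTRED ENGINE AT THE MODEL**: with `δ = 1∕64`, Wilson coefficient `κ₃ = kap3∕8` and per-bond
multiplicity `m₃ = κ₃S`, `2δ + 8ρm₃ ≤ 1∕16 = a_c` (from module 52's `2ρ·kap3·S ≤ 1∕32`).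
[cite: Balaban1988RG2Cluster, (2.20) p.16, (2.24) p.17] -/
theorem rate_centred_model (c : B13.Consts) (t : Finset (TDom d (L * N')) × Finset (TBond d M (L * N')))
    (hτ : ∀ x : ℝ, 0 ≤ x → 0 < invTau c x ∧ invTau c x ≤ 1 / 2) {ρ : ℝ} (hρ : 0 ≤ ρ) :
    0 < kap3 c t ρ / 8 ∧ 2 * (1 / 64 : ℝ) + 8 * ρ * (kap3 c t ρ / 8 * SR c t) ≤ 1 / 16 := by
  obtain ⟨hκ₃, -, h16, -⟩ := rates_localGrowth_model 0 c t hτ hρ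
  have h0 := rhoB_pos 0
  have hx : 0 ≤ 2 * ρ * (kap3 c t ρ * SR c t) := by have := SR_nonneg c t hτ; positivity
  have h1 : 2 * ρ * (kap3 c t ρ * SR c t) ≤ (1 + rhoB 0) ^ 2 * (2 * ρ * (kap3 c t ρ * SR c t)) := by
    have h2 : (1 : ℝ) ≤ (1 + rhoB 0) ^ 2 := by nlinarith
    calc 2 * ρ * (kap3 c t ρ * SR c t) = 1 * (2 * ρ * (kap3 c t ρ * SR c t)) := (one_mul _).symm
      _ ≤ (1 + rhoB 0) ^ 2 * (2 * ρ * (kap3 c t ρ * SR c t)) := mul_le_mul_of_nonneg_right h2 hx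
  refine ⟨by positivity, ?_⟩
  have h3 : 8 * ρ * (kap3 c t ρ / 8 * SR c t) = (2 * ρ * (kap3 c t ρ * SR c t)) / 2 := by ring
  rw [h3]; linarith

/-- MODEL (witness data). THE WEIGHTED-CONSTANTS EXPRESSION of the centred engine's letter `hwc` at the model's constants
(`R = R_τ`, `c₀ = 1`, `c₃ = c₃′ = κ₃`, `c₄ = 0`, `c₁ = c₁′ = κ₁`, `c₂ = 0`, `δ = 1∕64`) — taken as `w_c` itself.
[cite: Balaban1988RG2Cluster, (2.20) p.16] -/
def wcModel (c : B13.Consts) (t : Finset (TDom d (L * N')) × Finset (TBond d M (L * N'))) (ρ κ₃ κ₁ : ℝ) : ℝ :=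
  Real.exp (∑ Y ∈ t.1, Rτ c Y * (1 : ℝ))
    * ((∑ Y ∈ t.1, Rτ c Y * ((4 * (0 : ℝ) + (4 * κ₃ + 4 * κ₃) / ρ) * (4 / (Real.exp 1 * (1 / 64 : ℝ))) ^ 4
          + ((0 : ℝ) + (κ₁ + κ₁) / ρ) * (2 / (Real.exp 1 * (1 / 64 : ℝ))) ^ 2)) * Real.exp ((1 / 64 : ℝ) / 2)
       + ((∑ Y ∈ t.1, Rτ c Y * (4 * κ₃ * (3 / (Real.exp 1 * (1 / 64 : ℝ))) ^ 3 + κ₁ * (1 / (Real.exp 1 * (1 / 64 : ℝ)))))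
            * Real.exp ((1 / 64 : ℝ) / 2)) ^ 2
          * Real.exp ((∑ Y ∈ t.1, Rτ c Y * ((1 : ℝ) + κ₁ * ρ)) + ∑ Y ∈ t.1, Rτ c Y * (1 : ℝ)))

/-- `0 ≤ w_c` at the model (all constants and τ-radii are non-negative). [cite: Balaban1988RG2Cluster, (2.20) p.16] -/
theorem wcModel_nonneg (c : B13.Consts) (t : Finset (TDom d (L * N')) × Finset (TBond d M (L * N')))
    (hτ : ∀ x : ℝ, 0 ≤ x → 0 < invTau c x ∧ invTau c x ≤ 1 / 2) {ρ κ₃ κ₁ : ℝ} (hρ : 0 ≤ ρ) (hκ₃ : 0 ≤ κ₃) (hκ₁ : 0 ≤ κ₁) :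
    0 ≤ wcModel c t ρ κ₃ κ₁ := by
  have hR := fun Y => (Rτ_pos c hτ (d := d) (L := L) (N' := N') Y).le
  unfold wcModel
  have h1 : 0 ≤ ∑ Y ∈ t.1, Rτ c Y * ((4 * (0 : ℝ) + (4 * κ₃ + 4 * κ₃) / ρ) * (4 / (Real.exp 1 * (1 / 64 : ℝ))) ^ 4
      + ((0 : ℝ) + (κ₁ + κ₁) / ρ) * (2 / (Real.exp 1 * (1 / 64 : ℝ))) ^ 2) :=
    Finset.sum_nonneg fun Y _ => mul_nonneg (hR Y) (by positivity)
  positivity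

/-- `w_c ≤ e^{w_c}`: the model's weighted-constants letter `hwc` holds with `w_c := wcModel`.
[cite: Balaban1988RG2Cluster, (2.20) p.16] -/
theorem wcModel_le_exp (c : B13.Consts) (t : Finset (TDom d (L * N')) × Finset (TBond d M (L * N'))) (ρ κ₃ κ₁ : ℝ) :
    wcModel c t ρ κ₃ κ₁ ≤ Real.exp (wcModel c t ρ κ₃ κ₁) := by
  linarith [Real.add_one_le_exp (wcModel c t ρ κ₃ κ₁)]

end Letters

/-! ## §2. THE WITNESS: the centred local-growth member engine's binder list is met at the model -/

section Witness

variable {d L N' : ℕ} [NeZero L] [NeZero N'] {M : ℕ}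

open Classical in
/-- **JOINT SATISFIABILITY OF THE CENTRED LOCAL-GROWTH MEMBER ENGINE's BINDER LIST (A2 ∕ A6 WITNESS):**
`B13Bound226CentredUnscaled.h226_torus_windowDilated_centred_of_localGrowth_perBond_member` APPLIED at the model with EVERY
binder discharged — for every torus ∕ site torus ∕ `Z` ∕ term label ∕ `r_P` ∕ coupling `s > 0` and every `c` with `κ₁ ≥ 1`,
`α₆ ≠ 0` and the (2.18) law: kernels, regions, rates, letters, `ρ_b`, primed letters, `θ`, `c_E`, `g` as in
`B13Bound226Witness.h226_windowDilated_model`; (2.22) by `h222_model`; parity by `chi_even`; last line `𝒲 = 𝒲₃ = Wc (kap3∕8)`,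
`𝒪 = Oa kap1`, `D𝒪 = DOa kap1` at clipping radius `ρ = s√(r_P²|P|+1) > 0` (box-SUPPORT law `boxSupport_model`, locality in
`S₀ = univ`), local letters (L0)–(L6) by `Oa_letters` ∕ `Wc_cubic` ∕ `Wc_local` ∕ `Oa_taylor`, per-bond multiplicity
`perBond_model`, rate `rate_centred_model` (`δ = 1∕64`, `a_c = 1∕16`), `w_c := wcModel` (`wcModel_le_exp`), `hvol` by
`vol_model` (`a₅ = 1 + w_c`), `a = r_P²∕16`.  Conclusion: for every `b` of the NON-EMPTY ball `|b − 1| < ρ_b`, the centred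
difference obeys the engine's bound `s²·(weight·e^{a₅|Z|})`.  HONEST LABEL as in module 52: σ-constant kernels; what is
certified is the joint CONSISTENCY of the ≈ 110 binders, each `∀` over a non-empty domain; nothing of Bałaban's asserted.
[cite: Balaban1988RG2Cluster, (2.14)–(2.15) p.15, (2.16)–(2.22) p.16, (2.23)–(2.26) p.17, (1.39) p.10, (1.42) p.11; Balaban1987RG1, (2.9)-(2.13) pp.266-268] -/
theorem centred_localGrowth_model {ν : ℕ} (Nf : Fin ν → ℕ) [∀ i, NeZero (Nf i)] (c : B13.Consts) (hκ₁ : 1 ≤ c.κ₁)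
    (hα₆ : c.α₆ ≠ 0) (hτ : ∀ x : ℝ, 0 ≤ x → 0 < invTau c x ∧ invTau c x ≤ 1 / 2)
    (Z : TDom d N') (t : Finset (TDom d (L * N')) × Finset (TBond d M (L * N'))) (rP : ℝ) {s : ℝ} (hs : 0 < s) :
    ∀ b ∈ ball (1 : ℂ) (rhoB ν),
      ‖term214 (Real.exp c.κ₁ - 1) (Z.1 \ tclosure L N' (Z0 M t)).toList t.1.toList
            (core214 (fun _ => b ^ 2 • (1 : Matrix (Fin 1) (Fin 1) ℂ)) (fun _ X => b • Γm X)
              (F214 t.2.card (chiS (rP ^ 2 * t.2.card + 1)) (chiL (rP ^ 2 * t.2.card)) t.1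
                (fun Y B => b ^ 2 * ((((s : ℝ) : ℂ) ^ 2)⁻¹ * Wc (kap3 c t (rhoClip s rP t.2.card) / 8) Y (s • B))
                  + Oa (kap1 (rhoClip s rP t.2.card)) Y (s • B)))) 0 0
          - term214 (Real.exp c.κ₁ - 1) (Z.1 \ tclosure L N' (Z0 M t)).toList t.1.toList
            (core214 (fun _ => b ^ 2 • (1 : Matrix (Fin 1) (Fin 1) ℂ)) (fun _ X => b • Γm X)
              (F214 t.2.card (chiS (rP ^ 2 * t.2.card + 1)) (chiL (rP ^ 2 * t.2.card)) t.1
                (fun Y _ => Oa (kap1 (rhoClip s rP t.2.card)) Y 0))) 0 0‖ ≤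
        s ^ 2 * (weight L M c Z (1 / 16 * rP ^ 2) t *
          Real.exp ((1 + wcModel c t (rhoClip s rP t.2.card) (kap3 c t (rhoClip s rP t.2.card) / 8)
            (kap1 (rhoClip s rP t.2.card))) * ((Z.1).card : ℝ))) := by
  set ρ := rhoClip s rP t.2.card with hρdef
  obtain ⟨hpos, hhalf, hr, hUtau, hsubτ⟩ := regions_model c hκ₁ hτ (d := d) (L := L) (N' := N')
  have hρ0 : 0 < ρ := by rw [hρdef]; unfold rhoClip; positivity
  obtain ⟨hκ₃, hac⟩ := rate_centred_model c t hτ hρ0.le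
  obtain ⟨-, hκ1, -, -⟩ := rates_localGrowth_model ν c t hτ hρ0.le
  obtain ⟨⟨hρ1, hKG', hKCs', hθΓ', hθC', hθE', -⟩, ⟨hθEle, hθΓle⟩, ⟨-, hsmallKθ⟩, h2θ⟩ :=
    And.intro (transports_model ν) (And.intro (rhoB_le_thetaW ν) (And.intro (hsmallKθ_model ν) (two_theta_F_le ν)))
  obtain ⟨hG, hΓ₀, hCs, hC216, hCE, hdΓ, hdC, hdE⟩ := letters_model Nf (ι := TPt d N')
  have hZ1 : (1 : ℝ) ≤ ((Z.1).card : ℝ) := by exact_mod_cast Finset.card_pos.mpr Z.2.1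
  have hwc0 := wcModel_nonneg c t hτ hρ0.le hκ₃.le hκ1.le
  have hvol := vol_model ν hwc0 hZ1
  intro b hb
  exact h226_torus_windowDilated_centred_of_localGrowth_perBond_member c hκ₁ hα₆ Z t hpos hhalf (Uσ := Set.univ)
    (Uτ := fun Y => ball (0 : ℂ) (Rτ c Y)) isOpen_univ (fun _ => isOpen_ball) (Set.subset_univ _) hUtau hr le_rfl hsubτ
    _ ⟨Finset.nodup_toList _, Finset.toList_toFinset _⟩ _ ⟨Finset.nodup_toList _, Finset.toList_toFinset _⟩
    (fun _ => (1 : Matrix (Fin 1) (Fin 1) ℂ)) (fun _ X => Γm X) (chiS_nonneg _) (chiL_nonneg _)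
    (fun B => (chi_even (rP ^ 2 * t.2.card + 1) (rP ^ 2 * t.2.card) B).1)
    (fun B => (chi_even (rP ^ 2 * t.2.card + 1) (rP ^ 2 * t.2.card) B).2) t.1
    (Wc (kap3 c t ρ / 8)) (Wc (kap3 c t ρ / 8)) (Oa (kap1 ρ)) (DOa (kap1 ρ)) hs hρ0
    (fun Y => (measurable_Wc_Oa (kap3 c t ρ / 8) (kap1 ρ) Y).1) (fun Y => (measurable_Wc_Oa (kap3 c t ρ / 8) (kap1 ρ) Y).2)
    (fun Y => (measurable_Wc_Oa (kap3 c t ρ / 8) (kap1 ρ) Y).1) (fun Y => measurable_DOa _ Y)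
    (fun Y r A => Wc_smul _ Y r A) (fun Y r A => DOa_smul _ Y r A)
    Matrix.PosDef.one Gam0 (fun _ _ => differentiableOn_const _) (measurable_chiS _) (measurable_chiL _)
    (fun _ _ => Matrix.isSymm_one) (fun _ => Gm) (fun _ _ => differentiableOn_const _) (fun _ _ _ => rfl)
    (γ₂ := 1 / 16) (rP := rP) (ac := 1 / 16) (δ := 1 / 64) (fun B => B ⬝ᵥ B)
    (fun B => h222_model _ (by norm_num) rP t.2.card B) (by norm_num) (fun _ => le_rfl) (by norm_num)
    (R := Rτ c) (c₀ := fun _ => (1 : ℝ)) (c₃ := fun _ => kap3 c t ρ / 8) (c₃' := fun _ => kap3 c t ρ / 8)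
    (c₄ := fun _ => (0 : ℝ)) (c₁ := fun _ => kap1 ρ) (c₁' := fun _ => kap1 ρ) (c₂ := fun _ => (0 : ℝ))
    (fun Y _ => (Rτ_pos c hτ Y).le) (fun _ _ => hκ₃.le) (fun _ _ => hκ₃.le) (fun _ _ => le_rfl) (fun _ _ => hκ1.le)
    (fun _ _ => hκ1.le) (fun _ _ => le_rfl) (fun Y _ z hz => (mem_ball_zero_iff.mp hz).le)
    (fun Y _ => (Oa_letters hκ1.le Y 0).1) (fun Y _ A _ => (Wc_cubic hκ₃.le Y A).1) (fun _ => Finset.univ)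
    (fun Y _ A _ => Wc_local hκ₃.le Y A) (m₃ := kap3 c t ρ / 8 * SR c t) (mul_nonneg hκ₃.le (SR_nonneg c t hτ))
    (perBond_model c t _) (fun Y _ A _ => (Wc_cubic hκ₃.le Y A).2) (fun Y _ A => (Wc_cubic hκ₃.le Y A).1)
    (fun Y _ A _ => (Oa_letters hκ1.le Y A).2) (fun Y _ A _ => (Oa_taylor hκ1.le Y A).1)
    (fun Y _ A => (Oa_taylor hκ1.le Y A).2)
    Set.univ (fun B hB b hb => boxSupport_model hs.le rP t.2.card B hB b hb)
    (fun Y _ A A' h => local_model _ Y A A' h) (fun Y _ A A' h => local_model _ Y A A' h) hac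
    (wc := wcModel c t ρ (kap3 c t ρ / 8) (kap1 ρ)) (wcModel_le_exp c t ρ _ _)
    (fun _ => x0 Nf) (fun _ => x0 Nf) (m := 1) (fib_model_Λ Nf) (fib_model_N Nf)
    (kap := 3) (kap' := 2) (kap'' := 1) (θ := thetaW ν) (θE := 0) (θΓ := 0) (θC := 0) (KG := 1 / 2) (KΓ := 1 / 2)
    (KCs := 1) (K₀ := 1) (KE := 1) (by norm_num) (by norm_num) (by norm_num) le_rfl le_rfl le_rfl (by norm_num)
    (by norm_num) zero_le_one zero_le_one zero_le_one hG hΓ₀ hCs hC216 hCE hdΓ hdC hdE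
    (ρb := rhoB ν) (KG' := 1) (KCs' := 4) (θΓ' := rhoB ν / 2) (θC' := 10 * rhoB ν) (θE' := 3 * rhoB ν)
    hρ1 hKG' hKCs' hθΓ' hθC' hθE' hθEle hθΓle (hθR1le_model ν) hsmallKθ
    (cE := 1) (g := 1 / 4) zero_le_one (eigenvalues_one_le Matrix.PosDef.one) (by nlinarith [h2θ]) (by norm_num) Gam0_form
    (by nlinarith [h2θ]) (a := 1 / 16 * rP ^ 2) (a₅ := 1 + wcModel c t ρ (kap3 c t ρ / 8) (kap1 ρ)) le_rfl hvol hb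

end Witness

end Literature.MathematicalPhysics.QuantumFieldTheory.Balaban1983to89.B13Bound226WitnessCentred

end
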